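import Summits.PneNP.PneNP.Theses.MetaCplx

/-!
# Route MetaCplx — `Assembly` (stmt-PneNP-10543)

`Assembly := MetacplxThesis → PneNP` is literally the type of the route's deciding theorem
`Summit.PneNP.PneNP.Theses.MetaCplx.closes` (proved in the route file: one-way functions ⇒
`NP ⊄ P` by search-to-decision, Goldreich 2001 §2.7.4 Ex. 2, plus the proved model bridges).
This file imports only the route file.
-/

set_option linter.dupNamespace false -- `Summit.PneNP.PneNP.…`: summit = sub-problem name (D-0017 single-conjunct layout)

namespace Summit.PneNP.PneNP.Theorems

/-- **Assembly item of route MetaCplx (stmt-PneNP-10543)**: `MetacplxThesis → PneNP`, by the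
route's deciding theorem `MetaCplx.closes`. [cite: Goldreich2001, §2.7.4 Exercise 2] -/
theorem metaCplx_assembly_proof : Summit.PneNP.PneNP.Theses.MetaCplx.Assembly := by
  unfold Summit.PneNP.PneNP.Theses.MetaCplx.Assembly
  exact fun hX => Summit.PneNP.PneNP.Theses.MetaCplx.closes hX

end Summit.PneNP.PneNP.Theorems
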